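import Mathlib

/-!
# Bałaban CMP 109 (1987) §4 pp. 289–292: the localized coefficient table (4.34), its reduction (4.43) ⇒ (4.44),
the vanishing (4.45), and the algebraic reason the marginal terms (4.42) + (4.44) are the first variation of
`¼ Σ tr F²` — kernel certificate of the printed bookkeeping

CITATION HEADER (lean-in-tree rule 2026-08-18).  Source: T. Bałaban, *Renormalization group approach to lattice
gauge field theories. I. Generation of effective actions in a small field approximation and a coupling constant
renormalization in four dimensions*, Commun. Math. Phys. **109**, 249–301 (1987), doi:10.1007/bf01215223
[Balaban1987RG1] (held: `paper:balaban1987-cmp109-rg-i-small-field`; journal page = PDF page + 248).  The displays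
and sentences quoted below were READ AS IMAGES on the 300-dpi renders of p. 285 [PDF 37], p. 286 [38], p. 288 [40],
p. 289 [41], p. 290 [42], p. 291 [43] and p. 292 [44] (`HOME/b2b-balaban-ref1/pages/1987-cmp109-rg-I-small-field/
…-p037-x2.png` … `…-p044-x2.png`, HOME = the audit cell folder `run/shared/lean/pub/pub-balaban/`) and agree with the
audited lineage transcript `HOME/b2b-balaban-b03/B12s-transcript.md` (§4, pp. 281–292).  Audit cell `pub-balaban`,
unit `b2b-balaban-b03-g8` (B12 §§2–5 lineage), node B12-MARGINAL-444.  Imports Mathlib only; modifies nothing.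
Value = kernel certificate of printed bookkeeping (finite sums, bilinearity of the trace, the cyclicity of the trace,
the Jacobi-free bracket algebra, Leibniz' rule), NOT summit progress; nothing is asserted about Bałaban's functions
`E^{(n)}`, the Ward–Takahashi reductions (4.21)–(4.31) themselves, the irrelevance of any dropped term, the operator
`Δ_j` of (1.66) [10], or the sign or size of β (cell GAPS G-B12s-*, the BETA table).

THE PRINTED TEXT (verbatim; E = the print's boldface E; `i[·,·]` is the print's bracket, cf. (4.8) p. 283
«exp i(exp i ad_{λ(b₋)} B(b))»).
* p. 285, (4.20): «(4.6) = Σ_{n=2}^{4} (1/(n−1)!) ⟨E^{(n)}, δB, ⊗^{n−1} B⟩.  (4.20)»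
* p. 286, (4.23) and the sentence before it: «Consider now the first sum in (4.21). The last factor B_{μ₃}(x) is
  constant as a function of x₃, and we have  B_{μ₃}(x) = (∂_{μ₃}λ_x)(x₃),  λ_x(x₃) = Σ_{ν=1}^{4} (x_{3,ν} − x_ν)B_ν(x).
  (4.23)»; p. 287: «… is equal to −½ i[δB_μ(x), B_μ(x)], because λ_x(x) = 0.»
* p. 288: «We can still simplify expressions in the last equalities in (4.27), (4.28), replacing all fields B by their
  values at the point x. The difference B(·) − B(x) = (∂B)(Γ_{x,·}) gives rise to irrelevant terms. Thus the equalities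
  (4.21), (4.24), and the simplified equalities (4.27), (4.28) yield
  ⟨E^{(4)}, δB, ⊗³B⟩ = 2⟨E^{(2)}, δB, i[λ_x, i[λ_x, B(x)]]⟩ − ⟨E^{(2)}, δB, i[i[λ_x, B(x)], ∂λ_x]⟩
  − (3/2)⟨E^{(2)}, i[δB, B], i[λ_x, B(x)]⟩ + (the irrelevant terms).  (4.29)»;
  p. 288, last display: «Let us denote  B_{μ₃}(x₃, x) = Σ_{ν=1}^{4} (x_{3,ν} − x_ν)(∂_νB_{μ₃})(x).»
* p. 289, (4.31), last equality: «= ⟨E^{(2)}, δB, i[λ_x, B(x)]⟩ + 2⟨E^{(2)}, δB, i[λ_x, B(·, x)]⟩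
  − ⟨E^{(2)}, δB, i[B(·, x), B(x)]⟩ − ⟨E^{(2)}, i[δB, B], B(·, x)⟩ + (the irrelevant terms).  (4.31)
  Here, in the last equality, all fields and their derivatives are taken at the point x.»
* p. 289: «With our assumptions on the group G the identity (4.33) holds for E if and only if E_{ab} is proportional
  to the identity matrix, E_{ab} = Eδ_{ab}, and then ⟨E, A⊗B⟩ = E tr AB. This gives a further simplification of the
  expressions in (4.29), (4.31).  Let us write the result of the preceding analysis
  (4.6) = Σ_{(x,μ),(y,ν)} E^{(2)}_{μ,ν}(X, x, y) tr δB_μ(x)B_ν(y)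
  + Σ_x Σ_{μ,ν,κ,λ} (Σ_y E^{(2)}_{μ,ν}(X, x, y)(y_κ − x_κ)(y_λ − x_λ))
    × {tr δB_μ(x)i[B_κ(x), (∂_λB_ν)(x)] + ⅓ tr δB_μ(x)i[B_κ(x), i[B_λ(x), B_ν(x)]]}
  + Σ_x Σ_{μ,ν,κ} (Σ_y E^{(2)}_{μ,ν}(X, x, y)(y_κ − x_κ)) {½ tr δB_μ(x)i[B_κ(x), B_ν(x)]»  (p. 290, continued)
  «− ½ tr δB_μ(x)i[(∂_κB_ν)(x), B_ν(x)] − ½ tr δB_μ(x)i[B_μ(x), (∂_κB_ν)(x)] − (1/3!) tr δB_μ(x)i[i[B_κ(x), B_ν(x)], B_ν(x)]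
  − ¼ tr δB_μ(x)i[B_μ(x), i[B_κ(x), B_ν(x)]]} + (the irrelevant terms).  (4.34)
  The sums over x above are restricted to supp δB ⊂ □, and the sums over y are restricted to supp B ⊂ supp ζ̃_□. The
  expressions in this formula are local polynomials in the fields δB, B. The first expression on the right-hand side,
  which is simply ⟨E^{(2)}(X), δB, B⟩, is not analyzed yet. […] The second expression is already in an almost correct
  form; we have to use only Euclidean symmetries to reduce it to a final form. By the Euclidean symmetries the third
  expression should vanish.»
* p. 291: «This implies that the first term in (4.34), written for (4.40) instead of E^{(2)}, is represented as
  β_j(g_{j−1})½ Σ_{x,μ,ν} tr(∂δB)_{μν}(x)(∂B)_{μν}(x) + (irrelevant terms).  (4.42)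
  In the second term we have the expression
  β_j(g_{j−1})Σ_y Δ_{j,μν}(x − y)(y_κ − x_κ)(y_λ − x_λ) = −β_j(g_{j−1})((∂²/∂p′_κ∂p′_λ)Δ_{j,μν})(0)
  = β_j(g_{j−1})(δ_{μκ}δ_{νλ} + δ_{μλ}δ_{νκ} − 2δ_{μν}δ_{κλ}).  (4.43)
  Using this equality we represent the second term as
  β_j(g_{j−1}) Σ_{x,μ,ν} tr δB_μ(x){i[B_ν(x), (δB)_{μν}(x)] + i[B_μ(x), (∂_νB_ν)(x)] + i[(∂_νB_μ)(x), B_ν(x)]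
  + i[B_ν(x), i[B_μ(x), B_ν(x)]]}.  (4.44)»
* p. 292: «In the third term we have the expression
  β_j(g_{j−1})Σ_y Δ_{k,μν}(x − y)(y_κ − x_κ) = β_j(g_{j−1})((1/i)(∂/∂p′_κ)Δ_{j,μν})(0) = 0,  (4.45)
  hence this term vanishes. Thus the only terms in the expansion of (4.38), which we do not control yet, more exactly
  for which the sum over j has not a uniform bound, are terms (4.42), (4.44). In the next section we will prove that
  the polarization tensor Π has a similar structure as the operator Δ_j, especially it has an expansion of the form
  (4.41), but with a coefficient. We define the β-function β_j(g_{j−1}) equal to this coefficient. The corresponding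
  terms from (4.34) are equal to (4.42), (4.44) also, hence both groups of terms cancel, because (4.38) appears with the
  minus sign in the effective action (1.6).»  (sic «Δ_{k,μν}» in (4.45); read Δ_{j,μν}.)

TWO PRINT-LEVEL REMARKS this module settles (cell GAPS; lineage transcript).
(M1) (4.44) prints «i[B_ν(x), (δB)_{μν}(x)]».  With the field-strength reading `(∂B)_{μν} := ∂_μB_ν − ∂_νB_μ` (as
     in (4.42) «(∂B)_{μν}») the display is EXACTLY what (4.34)₂ and (4.43) give (`block2_of_moments443` below); with
     a δB inside the bracket the term would be quadratic in δB, contradicting «tr δB_μ(x){…}» being the part linear in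
     δB.  So «(δB)_{μν}» is a misprint for «(∂B)_{μν}» (cell GAPS G-B12s-M; this module is its kernel witness).
(M2) The third block of (4.34) (indices «B_ν(x)» twice, «B_μ(x)» inside the κ-moment brackets) was tagged
     «plausibly misprinted indices» in the lineage transcript (M-4.34).  It is NOT misprinted: with the componentwise
     (bond-wise) brackets of (4.8) — `i[δB, B]_μ = i[δB_μ, B_μ]`, `(∂λ_x)_ν = B_ν(x)` by (4.23) — the expressions
     (4.29), (4.31) with the weights 1/3!, 1/2! of (4.20) give the printed third block LETTER FOR LETTER (`eq434`;
     hand certification GAPS C-adv9-13, whose ERRATUM this kernel check confirms).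

THE DICTIONARY (everything at ONE point x; the paper's sums over x and the localization domains X are not modelled —
(4.34) is an identity summand by summand in x).
* Scalars `𝕜` (a field of characteristic 0; ℂ in the paper), a commutative `𝕜`-algebra `A` of "values" (ℂ for the
  pointwise Part 1–2; an algebra of functions for Part 3), `n × n` matrices over `A` (the Lie algebra 𝔤 ⊂ u(n) and
  its complexification; the trace form «tr AB»), directions `Fin d` (d = 4 in print; arbitrary here), a finite type
  `Y` of points y (the y-sums of (4.34) are finite: «restricted to supp B»).
* `ibr c X Y = c • (X*Y − Y*X)` is the print's `i[X, Y]` (c = i; any scalar c works and is kept as a parameter).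
* `E : Fin d → Fin d → Y → A` is `E^{(2)}_{μ,ν}(X, x, y)` after the reduction «⟨E, A⊗B⟩ = E tr AB» of p. 289;
  `pairE E f g = Σ_μ Σ_ν Σ_y E μ ν y · tr(f_μ g_ν(y))` is `⟨E^{(2)}, f, g⟩` with the first field localized at x.
* `disp : Y → Fin d → A` is `y ↦ (y_κ − x_κ)_κ`; `lam disp B y = Σ_κ disp y κ • B κ` is λ_x(y) of (4.23);
  `Bxy disp C y ν = Σ_λ disp y λ • C λ ν` is B_ν(y, x) of p. 288 with `C λ ν = (∂_λB_ν)(x)`;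
  `M1 E disp μ ν κ = Σ_y E μ ν y · disp y κ` and `M2 E disp μ ν κ λ = Σ_y E μ ν y · disp y κ · disp y λ` are the
  first and second moment kernels «Σ_y E^{(2)}_{μ,ν}(X,x,y)(y_κ − x_κ)», «…(y_κ − x_κ)(y_λ − x_λ)» of (4.34).
* The bond-wise composite fields of (4.29)/(4.31): `i[δB, B]_μ = ibr c (δB μ) (B μ)` (p. 287 «−½ i[δB_μ(x), B_μ(x)],
  because λ_x(x) = 0»), `i[λ_x, B(x)]_ν(y) = ibr c (lam y) (B ν)`, `i[λ_x, B(·,x)]_ν(y) = ibr c (lam y) (Bxy y ν)`,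
  `i[B(·,x), B(x)]_ν(y) = ibr c (Bxy y ν) (B ν)`, `i[λ_x, i[λ_x, B(x)]]_ν(y) = ibr c (lam y) (ibr c (lam y) (B ν))`,
  `i[i[λ_x, B(x)], ∂λ_x]_ν(y) = ibr c (ibr c (lam y) (B ν)) (B ν)` (using `(∂λ_x)_ν ≡ B_ν(x)`, (4.23) — on the unit
  lattice the forward difference of the LINEAR function λ_x is exactly B(x): `lamx_fdiff` below).
* Part 3: commuting derivations `D μ : Derivation 𝕜 A A` acting entrywise (`pd D μ M = M.map (D μ)`) stand for ∂_μ
  «at the point x»; `curl D X μ ν = ∂_μX_ν − ∂_νX_μ` is «(∂X)_{μν}»; `Fs D c B μ ν = (∂B)_{μν} + i[B_μ, B_ν]` is the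
  field strength of the Wilson action in the parametrization U(b) = exp(iηB(b)) (BCH: U(∂p) = exp(iη²F_{μν} + O(η³)),
  1 − Re tr U(∂p) = ½η⁴ tr F_{μν}² + …, so the action density per site is ¼ Σ_{μ,ν} tr F_{μν}², plaquettes counted
  once as μ < ν); `dF` its first variation in the direction δB; `ym`, `firstVar`, `dens442` (the density of (4.42)),
  `dens444` (the density of (4.44), = `dens444pt` at `C κ ν := ∂_κB_ν`), `cur` (the current whose divergence is the
  boundary term).  On the lattice ∂_μ is a finite difference and Leibniz' rule holds up to a product of differences —
  one more «irrelevant term» in the paper's bookkeeping; the formal identity below is the one the sentence «The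
  corresponding terms from (4.34) are equal to (4.42), (4.44)» p. 292 and the renormalization of the SINGLE coupling in
  front of the Wilson action rest on.  This idealization is this module's declared scope, not a claim about the paper's
  estimates.

WHAT IS PROVED (every `theorem` kernel-checked from the definitions; `d`, `n`, `Y` arbitrary; no hypothesis of the
series is used).
* §1 bracket algebra [folklore]: bilinearity of `ibr`, `ibr_self`, `ibr_anticomm`, and the trace identity
  `tr(i[X,Y] Z) = tr(X i[Y,Z])` (`trace_ibr_mul`, `trace_mul_ibr`; commutative entries).
* §2 (4.23) on the unit lattice `ℤ^d`: `lamx_self` (λ_x(x) = 0) and `lamx_fdiff` ((∂_μλ_x)(y) = B_μ(x) for EVERY y,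
  forward difference) [cite (4.23)].
* §3 the localization calculus: `pairE` against a field of first resp. second order in (y − x) is the first resp.
  second MOMENT kernel against the Taylor coefficient (`pairE_moment1`, `pairE_moment2`), and the seven expansions
  `termA` … `termG` of the seven E^{(2)}-expressions of (4.29), (4.31).
* §4 THE TABLE (4.34): `eq434` — ⟨E², δB, B⟩ + (1/2!)·[(4.31)] + (1/3!)·[(4.29)] = block 1 + block 2 + block 3 of
  (4.34) with EXACTLY the printed coefficients 1, ⅓ | ½, −½, −½, −1/3!, −¼ and the printed index pattern (M2).
* §5 (4.43) ⇒ (4.44) and (4.45): `block2_of_moments443` — if the second moments are β(δ_{μκ}δ_{νλ} + δ_{μλ}δ_{νκ}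
  − 2δ_{μν}δ_{κλ}) then block 2 = β · Σ_{μν} tr δB_μ{i[B_ν, (∂B)_{μν}] + i[B_μ, ∂_νB_ν] + i[∂_νB_μ, B_ν]
  + i[B_ν, i[B_μ, B_ν]]} (the cubic regrouping `cubic444` and the quartic contraction `quartic444`: the
  δ_{μκ}δ_{νλ}-piece of the quartic term vanishes by i[B_ν, B_ν] = 0 and the other two add up to 3 × ⅓ = 1);
  `block3_eq_zero_of_moments445` — if the first moments vanish, block 3 = 0; the moment tensor of (4.43) IS minus
  the Hessian at p′ = 0 of the transverse symbol p′²δ_{μν} − p′_μp′_ν (`neg_hessian_transverse`, exact partial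
  derivatives of `MvPolynomial`; the normalization Δ₀(p′) = p′² + O(p′⁴), ∂̄¹_μ(p′)∂¹_ν(p′) = p′_μp′_ν + O(|p′|³) of the
  symbols in (4.41) is the paper's by-reference input from [10], «see (1.29)–(1.37) [10]», and is NOT proved here), and
  its values `moments443_offdiag` (= β for κ = μ ≠ ν = λ:
  the normalization (5.42)/(1.22) «β = Σ_x Π_{μν}(x)x_μx_ν for μ ≠ ν») and `moments443_trace` (= −2β for
  μ = ν ≠ κ = λ).
* §6 THE FIELD-STRENGTH IDENTITY [folklore, continuum Yang–Mills calculus transcribed to commuting derivations]: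
  `Fs_add_smul` (F(B + tδB) = F + t δF + t² i[δB, δB]), `ym_add_smul` (¼Σ tr F(B + tδB)² = ¼Σ tr F² + t·firstVar
  + t²R₂ + t³R₃ + t⁴R₄, so `firstVar = ½ Σ tr F δF` IS the first variation), and
  `firstVar_eq`:  ½ Σ_{μν} tr(F_{μν} δF_{μν}) = ½ Σ tr((∂δB)_{μν}(∂B)_{μν}) + [the density of (4.44)]
  + Σ_μ ∂_μ(Σ_ν tr(i[B_μ, B_ν] δB_ν)),  i.e. (4.42)-density + (4.44)-density = δ(¼ Σ tr F²) − (a divergence);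
  `integral_firstVar` / `marginal_eq_firstVar`: for every 𝕜-linear functional ι vanishing on each image of ∂_μ
  («Σ_x» over the lattice) β·ι(4.42-density) + β·ι(4.44-density) = β·ι(δ ¼Σ tr F²) — the counterterm is β times
  the variation of the Wilson action's continuum density, which is why ONE coupling constant is renormalized.
NOT PROVED HERE / NOT CLAIMED: the Ward–Takahashi manipulations (4.21)–(4.31) producing the E^{(2)}-expressions (they
involve E^{(3)}, E^{(4)} and the identities (4.15); certified by hand as a section in the lineage transcript modulo the
asserted irrelevance bounds (4.22)/(4.30)); the irrelevance of any term; (4.36)–(4.41); the second-moment computation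
(4.43) for Bałaban's Δ_j (by reference to (1.66) [10]) or for Π (that is §5, (5.36)–(5.42): `…B12Transverse536`,
`…B12Rep537`, `…B12Form543` of this lineage); lattice (finite-difference) versions of §6.
-/

namespace Literature.MathematicalPhysics.QuantumFieldTheory.Balaban1983to89.B12Marginal444

/-! ## §1. The bracket `i[X, Y]` on matrices with commuting entries -/

section Bracket

variable {𝕜 : Type*} [Field 𝕜]
variable {A : Type*} [CommRing A] [Algebra 𝕜 A]
variable {n : Type*} [Fintype n]

/-- The print's bracket `i[X, Y] = i(XY − YX)` ((4.8) p. 283, «i ad_λ B»), with the scalar `i` kept as a parameter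
`c`. [cite: Balaban1987RG1, (4.8) p.283] -/
def ibr (c : 𝕜) (X Y : Matrix n n A) : Matrix n n A := c • (X * Y - Y * X)

/-- Additivity of `i[·, Y]`. [folklore] -/
theorem ibr_add_left (c : 𝕜) (X X' Y : Matrix n n A) : ibr c (X + X') Y = ibr c X Y + ibr c X' Y := by
  simp only [ibr, Matrix.add_mul, Matrix.mul_add, ← smul_add]
  congr 1
  abel

/-- Additivity of `i[X, ·]`. [folklore] -/
theorem ibr_add_right (c : 𝕜) (X Y Y' : Matrix n n A) : ibr c X (Y + Y') = ibr c X Y + ibr c X Y' := by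
  simp only [ibr, Matrix.add_mul, Matrix.mul_add, ← smul_add]
  congr 1
  abel

/-- `i[X − X', Y] = i[X, Y] − i[X', Y]`. [folklore] -/
theorem ibr_sub_left (c : 𝕜) (X X' Y : Matrix n n A) : ibr c (X - X') Y = ibr c X Y - ibr c X' Y := by
  simp only [ibr, Matrix.sub_mul, Matrix.mul_sub, ← smul_sub]
  congr 1
  abel

/-- `i[X, Y − Y'] = i[X, Y] − i[X, Y']`. [folklore] -/
theorem ibr_sub_right (c : 𝕜) (X Y Y' : Matrix n n A) : ibr c X (Y - Y') = ibr c X Y - ibr c X Y' := by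
  simp only [ibr, Matrix.sub_mul, Matrix.mul_sub, ← smul_sub]
  congr 1
  abel

/-- `i[0, Y] = 0`. [folklore] -/
@[simp] theorem ibr_zero_left (c : 𝕜) (Y : Matrix n n A) : ibr c 0 Y = 0 := by simp [ibr]

/-- `i[X, 0] = 0`. [folklore] -/
@[simp] theorem ibr_zero_right (c : 𝕜) (X : Matrix n n A) : ibr c X 0 = 0 := by simp [ibr]

/-- `A`-homogeneity in the left slot (a "function value" pulled out of the bracket). [folklore] -/
theorem ibr_smul_left (c : 𝕜) (a : A) (X Y : Matrix n n A) : ibr c (a • X) Y = a • ibr c X Y := by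
  simp only [ibr, Matrix.smul_mul, Matrix.mul_smul, ← smul_sub]
  rw [smul_comm]

/-- `A`-homogeneity in the right slot. [folklore] -/
theorem ibr_smul_right (c : 𝕜) (a : A) (X Y : Matrix n n A) : ibr c X (a • Y) = a • ibr c X Y := by
  simp only [ibr, Matrix.smul_mul, Matrix.mul_smul, ← smul_sub]
  rw [smul_comm]

/-- `𝕜`-homogeneity in the left slot. [folklore] -/
theorem ibr_kSmul_left (c t : 𝕜) (X Y : Matrix n n A) : ibr c (t • X) Y = t • ibr c X Y := by
  simp only [ibr, Matrix.smul_mul, Matrix.mul_smul, ← smul_sub]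
  rw [smul_comm]

/-- `𝕜`-homogeneity in the right slot. [folklore] -/
theorem ibr_kSmul_right (c t : 𝕜) (X Y : Matrix n n A) : ibr c X (t • Y) = t • ibr c X Y := by
  simp only [ibr, Matrix.smul_mul, Matrix.mul_smul, ← smul_sub]
  rw [smul_comm]

/-- Finite sums in the left slot. [folklore] -/
theorem ibr_sum_left {ι : Type*} (c : 𝕜) (s : Finset ι) (f : ι → Matrix n n A) (Y : Matrix n n A) :
    ibr c (∑ i ∈ s, f i) Y = ∑ i ∈ s, ibr c (f i) Y := by
  simp only [ibr, Finset.sum_mul, Finset.mul_sum, ← Finset.sum_sub_distrib, Finset.smul_sum]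

/-- Finite sums in the right slot. [folklore] -/
theorem ibr_sum_right {ι : Type*} (c : 𝕜) (s : Finset ι) (X : Matrix n n A) (f : ι → Matrix n n A) :
    ibr c X (∑ i ∈ s, f i) = ∑ i ∈ s, ibr c X (f i) := by
  simp only [ibr, Finset.sum_mul, Finset.mul_sum, ← Finset.sum_sub_distrib, Finset.smul_sum]

/-- `i[X, X] = 0` (used at (4.44): the `δ_{μκ}δ_{νλ}` piece of the quartic term vanishes). [folklore] -/
@[simp] theorem ibr_self (c : 𝕜) (X : Matrix n n A) : ibr c X X = 0 := by simp [ibr]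

/-- Antisymmetry `i[Y, X] = −i[X, Y]`. [folklore] -/
theorem ibr_anticomm (c : 𝕜) (X Y : Matrix n n A) : ibr c Y X = - ibr c X Y := by
  simp only [ibr, ← smul_neg, neg_sub]

/-- **The trace identity** `tr(i[X, Y] Z) = tr(X i[Y, Z])` (cyclicity of the trace; the entries commute).  This is
the step «⟨E², i[δB, B], g⟩ = Σ … tr δB_μ i[B_μ, g]» behind the fourth and fifth coefficients of (4.34)₃ and the
first coefficient of (4.34)₂. [folklore] -/
theorem trace_ibr_mul (c : 𝕜) (X Y Z : Matrix n n A) :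
    (ibr c X Y * Z).trace = (X * ibr c Y Z).trace := by
  simp only [ibr, Matrix.smul_mul, Matrix.mul_smul, Matrix.sub_mul, Matrix.mul_sub, Matrix.trace_smul,
    Matrix.trace_sub, Matrix.mul_assoc]
  rw [Matrix.trace_mul_comm Y (X * Z), Matrix.mul_assoc]

/-- The same identity read from the other side: `tr(Z i[X, Y]) = tr(X i[Y, Z])`. [folklore] -/
theorem trace_mul_ibr (c : 𝕜) (X Y Z : Matrix n n A) :
    (Z * ibr c X Y).trace = (X * ibr c Y Z).trace := by
  rw [Matrix.trace_mul_comm, trace_ibr_mul]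

end Bracket

/-! ## §2. (4.23): the linear gauge function `λ_x` on the unit lattice `ℤ^d` -/

section GaugeFunction

variable {d : ℕ} {M : Type*} [AddCommGroup M]

/-- `λ_x(y) = Σ_ν (y_ν − x_ν) B_ν(x)` of (4.23) p. 286 (the values `B_ν(x)` are elements of any additive group
`M`, e.g. matrices). [cite: Balaban1987RG1, (4.23) p.286] -/
def lamx (x : Fin d → ℤ) (B : Fin d → M) (y : Fin d → ℤ) : M := ∑ ν, (y ν - x ν) • B ν

/-- «λ_x(x) = 0» (p. 287). [cite: Balaban1987RG1, p.287] -/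
theorem lamx_self (x : Fin d → ℤ) (B : Fin d → M) : lamx x B x = 0 := by
  simp [lamx]

/-- **(4.23)**: the forward lattice difference of `λ_x` in direction μ is the constant `B_μ(x)`, at EVERY point y:
`λ_x(y + e_μ) − λ_x(y) = B_μ(x)`, i.e. «B_{μ₃}(x) = (∂_{μ₃}λ_x)(x₃)». [cite: Balaban1987RG1, (4.23) p.286] -/
theorem lamx_fdiff (x : Fin d → ℤ) (B : Fin d → M) (μ : Fin d) (y : Fin d → ℤ) :
    lamx x B (y + Pi.single μ 1) - lamx x B y = B μ := by
  simp only [lamx, ← Finset.sum_sub_distrib, ← sub_smul, Pi.add_apply]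
  have h : ∀ ν : Fin d, (y ν + (Pi.single μ 1 : Fin d → ℤ) ν - x ν - (y ν - x ν))
      = (Pi.single μ 1 : Fin d → ℤ) ν := by
    intro ν; ring
  simp_rw [h]
  rw [Fintype.sum_eq_single μ (fun ν hν => by simp [hν])]
  simp

end GaugeFunction

/-! ## §3. The localization calculus at the point x -/

section Pointwise

variable {𝕜 : Type*} [Field 𝕜]
variable {A : Type*} [CommRing A] [Algebra 𝕜 A]
variable {n : Type*} [Fintype n]
variable {d : ℕ} {Y : Type*} [Fintype Y]

/-- `⟨E^{(2)}, f, g⟩ = Σ_μ Σ_ν Σ_y E^{(2)}_{μ,ν}(X, x, y) tr f_μ(x) g_ν(y)` with the first field localized at the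
point x and the scalar kernel of p. 289 («⟨E, A⊗B⟩ = E tr AB»). [cite: Balaban1987RG1, (4.34) p.289] -/
def pairE (E : Fin d → Fin d → Y → A) (f : Fin d → Matrix n n A) (g : Fin d → Y → Matrix n n A) : A :=
  ∑ μ, ∑ ν, ∑ y, E μ ν y * (f μ * g ν y).trace

/-- `λ_x(y) = Σ_κ (y_κ − x_κ) B_κ(x)` ((4.23)), with `disp y κ = y_κ − x_κ`. [cite: Balaban1987RG1, (4.23) p.286] -/
def lam (disp : Y → Fin d → A) (B : Fin d → Matrix n n A) (y : Y) : Matrix n n A := ∑ κ, disp y κ • B κ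

/-- `B_ν(y, x) = Σ_λ (y_λ − x_λ)(∂_λB_ν)(x)` (p. 288, last display), with `C λ ν = (∂_λB_ν)(x)`.
[cite: Balaban1987RG1, p.288] -/
def Bxy (disp : Y → Fin d → A) (C : Fin d → Fin d → Matrix n n A) (y : Y) (ν : Fin d) : Matrix n n A :=
  ∑ l, disp y l • C l ν

/-- The first-moment kernel `Σ_y E^{(2)}_{μ,ν}(X, x, y)(y_κ − x_κ)` of (4.34)₃ / (4.45).
[cite: Balaban1987RG1, (4.34) p.289] -/
def M1 (E : Fin d → Fin d → Y → A) (disp : Y → Fin d → A) (μ ν κ : Fin d) : A := ∑ y, E μ ν y * disp y κ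

/-- The second-moment kernel `Σ_y E^{(2)}_{μ,ν}(X, x, y)(y_κ − x_κ)(y_λ − x_λ)` of (4.34)₂ / (4.43).
[cite: Balaban1987RG1, (4.34) p.289] -/
def M2 (E : Fin d → Fin d → Y → A) (disp : Y → Fin d → A) (μ ν κ l : Fin d) : A :=
  ∑ y, E μ ν y * (disp y κ * disp y l)

/-- **Localization, first order**: pairing against a field linear in `y − x` is the first-moment kernel against the
coefficient. [folklore] -/
theorem pairE_moment1 (E : Fin d → Fin d → Y → A) (disp : Y → Fin d → A) (f : Fin d → Matrix n n A)
    (G : Fin d → Fin d → Matrix n n A) :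
    pairE E f (fun ν y => ∑ κ, disp y κ • G κ ν) = ∑ μ, ∑ ν, ∑ κ, M1 E disp μ ν κ * (f μ * G κ ν).trace := by
  unfold pairE M1
  refine Finset.sum_congr rfl fun μ _ => Finset.sum_congr rfl fun ν _ => ?_
  simp only [Matrix.mul_smul, Matrix.trace_sum, Matrix.trace_smul, smul_eq_mul, Finset.mul_sum, Finset.sum_mul]
  rw [Finset.sum_comm]
  refine Finset.sum_congr rfl fun κ _ => Finset.sum_congr rfl fun y _ => ?_
  ring

/-- **Localization, second order**: pairing against a field quadratic in `y − x` is the second-moment kernel against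
the coefficient. [folklore] -/
theorem pairE_moment2 (E : Fin d → Fin d → Y → A) (disp : Y → Fin d → A) (f : Fin d → Matrix n n A)
    (G : Fin d → Fin d → Fin d → Matrix n n A) :
    pairE E f (fun ν y => ∑ κ, ∑ l, (disp y κ * disp y l) • G κ l ν)
      = ∑ μ, ∑ ν, ∑ κ, ∑ l, M2 E disp μ ν κ l * (f μ * G κ l ν).trace := by
  unfold pairE M2
  refine Finset.sum_congr rfl fun μ _ => Finset.sum_congr rfl fun ν _ => ?_
  simp only [Matrix.mul_smul, Matrix.trace_sum, Matrix.trace_smul, smul_eq_mul, Finset.mul_sum, Finset.sum_mul]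
  rw [Finset.sum_comm]
  refine Finset.sum_congr rfl fun κ _ => ?_
  rw [Finset.sum_comm]
  refine Finset.sum_congr rfl fun l _ => Finset.sum_congr rfl fun y _ => ?_
  ring

omit [Fintype Y] in
/-- `i[λ_x(y), Z] = Σ_κ (y_κ − x_κ) i[B_κ(x), Z]`. [folklore] -/
theorem ibr_lam (c : 𝕜) (disp : Y → Fin d → A) (B : Fin d → Matrix n n A) (y : Y) (Z : Matrix n n A) :
    ibr c (lam disp B y) Z = ∑ κ, disp y κ • ibr c (B κ) Z := by
  unfold lam
  rw [ibr_sum_left]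
  simp_rw [ibr_smul_left]

omit [Fintype Y] in
/-- `i[B_ν(y,x), Z] = Σ_λ (y_λ − x_λ) i[(∂_λB_ν)(x), Z]`. [folklore] -/
theorem ibr_Bxy_left (c : 𝕜) (disp : Y → Fin d → A) (C : Fin d → Fin d → Matrix n n A) (y : Y) (ν : Fin d)
    (Z : Matrix n n A) : ibr c (Bxy disp C y ν) Z = ∑ l, disp y l • ibr c (C l ν) Z := by
  unfold Bxy
  rw [ibr_sum_left]
  simp_rw [ibr_smul_left]

omit [Fintype Y] in
/-- `i[Z, B_ν(y,x)] = Σ_λ (y_λ − x_λ) i[Z, (∂_λB_ν)(x)]`. [folklore] -/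
theorem ibr_Bxy_right (c : 𝕜) (disp : Y → Fin d → A) (C : Fin d → Fin d → Matrix n n A) (y : Y) (ν : Fin d)
    (Z : Matrix n n A) : ibr c Z (Bxy disp C y ν) = ∑ l, disp y l • ibr c Z (C l ν) := by
  unfold Bxy
  rw [ibr_sum_right]
  simp_rw [ibr_smul_right]

omit [Fintype Y] in
/-- `i[λ_x(y), B_ν(y,x)] = Σ_{κ,λ} (y_κ − x_κ)(y_λ − x_λ) i[B_κ(x), (∂_λB_ν)(x)]`. [folklore] -/
theorem ibr_lam_Bxy (c : 𝕜) (disp : Y → Fin d → A) (B : Fin d → Matrix n n A)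
    (C : Fin d → Fin d → Matrix n n A) (y : Y) (ν : Fin d) :
    ibr c (lam disp B y) (Bxy disp C y ν) = ∑ κ, ∑ l, (disp y κ * disp y l) • ibr c (B κ) (C l ν) := by
  rw [ibr_lam]
  simp_rw [ibr_Bxy_right, Finset.smul_sum, smul_smul]

omit [Fintype Y] in
/-- `i[λ_x(y), i[λ_x(y), Z]] = Σ_{κ,λ} (y_κ − x_κ)(y_λ − x_λ) i[B_κ(x), i[B_λ(x), Z]]`. [folklore] -/
theorem ibr_lam_lam (c : 𝕜) (disp : Y → Fin d → A) (B : Fin d → Matrix n n A) (y : Y) (Z : Matrix n n A) :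
    ibr c (lam disp B y) (ibr c (lam disp B y) Z)
      = ∑ κ, ∑ l, (disp y κ * disp y l) • ibr c (B κ) (ibr c (B l) Z) := by
  rw [ibr_lam]
  simp_rw [ibr_lam c disp B y Z, ibr_sum_right, ibr_smul_right, Finset.smul_sum, smul_smul]

omit [Fintype Y] in
/-- `i[i[λ_x(y), Z], W] = Σ_κ (y_κ − x_κ) i[i[B_κ(x), Z], W]`. [folklore] -/
theorem ibr_ibr_lam (c : 𝕜) (disp : Y → Fin d → A) (B : Fin d → Matrix n n A) (y : Y) (Z W : Matrix n n A) :
    ibr c (ibr c (lam disp B y) Z) W = ∑ κ, disp y κ • ibr c (ibr c (B κ) Z) W := by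
  rw [ibr_lam, ibr_sum_left]
  simp_rw [ibr_smul_left]

variable (E : Fin d → Fin d → Y → A) (disp : Y → Fin d → A) (c : 𝕜) (δB B : Fin d → Matrix n n A)
  (C : Fin d → Fin d → Matrix n n A)

/-- (a) `⟨E², δB, i[λ_x, B(x)]⟩ = Σ_{μνκ} M1_{μνκ} tr δB_μ i[B_κ, B_ν]` (first term of (4.31)).
[cite: Balaban1987RG1, (4.31) p.289] -/
theorem termA : pairE E δB (fun ν y => ibr c (lam disp B y) (B ν))
    = ∑ μ, ∑ ν, ∑ κ, M1 E disp μ ν κ * (δB μ * ibr c (B κ) (B ν)).trace := by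
  simp_rw [ibr_lam]
  exact pairE_moment1 E disp δB (fun κ ν => ibr c (B κ) (B ν))

/-- (b) `⟨E², δB, i[λ_x, B(·,x)]⟩ = Σ_{μνκλ} M2_{μνκλ} tr δB_μ i[B_κ, ∂_λB_ν]` (second term of (4.31)).
[cite: Balaban1987RG1, (4.31) p.289] -/
theorem termB : pairE E δB (fun ν y => ibr c (lam disp B y) (Bxy disp C y ν))
    = ∑ μ, ∑ ν, ∑ κ, ∑ l, M2 E disp μ ν κ l * (δB μ * ibr c (B κ) (C l ν)).trace := by
  simp_rw [ibr_lam_Bxy]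
  exact pairE_moment2 E disp δB (fun κ l ν => ibr c (B κ) (C l ν))

/-- (c) `⟨E², δB, i[B(·,x), B(x)]⟩ = Σ_{μνκ} M1_{μνκ} tr δB_μ i[∂_κB_ν, B_ν]` (third term of (4.31)).
[cite: Balaban1987RG1, (4.31) p.289] -/
theorem termC : pairE E δB (fun ν y => ibr c (Bxy disp C y ν) (B ν))
    = ∑ μ, ∑ ν, ∑ κ, M1 E disp μ ν κ * (δB μ * ibr c (C κ ν) (B ν)).trace := by
  simp_rw [ibr_Bxy_left]
  exact pairE_moment1 E disp δB (fun κ ν => ibr c (C κ ν) (B ν))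

/-- (d) `⟨E², i[δB, B], B(·,x)⟩ = Σ_{μνκ} M1_{μνκ} tr δB_μ i[B_μ, ∂_κB_ν]` (fourth term of (4.31); the trace
identity moves the bracket off δB). [cite: Balaban1987RG1, (4.31) p.289] -/
theorem termD : pairE E (fun μ => ibr c (δB μ) (B μ)) (fun ν y => Bxy disp C y ν)
    = ∑ μ, ∑ ν, ∑ κ, M1 E disp μ ν κ * (δB μ * ibr c (B μ) (C κ ν)).trace := by
  have h := pairE_moment1 E disp (fun μ => ibr c (δB μ) (B μ)) C
  simp_rw [trace_ibr_mul] at h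
  exact h

/-- (e) `⟨E², δB, i[λ_x, i[λ_x, B(x)]]⟩ = Σ_{μνκλ} M2_{μνκλ} tr δB_μ i[B_κ, i[B_λ, B_ν]]` (first term of
(4.29)). [cite: Balaban1987RG1, (4.29) p.288] -/
theorem termE : pairE E δB (fun ν y => ibr c (lam disp B y) (ibr c (lam disp B y) (B ν)))
    = ∑ μ, ∑ ν, ∑ κ, ∑ l, M2 E disp μ ν κ l * (δB μ * ibr c (B κ) (ibr c (B l) (B ν))).trace := by
  simp_rw [ibr_lam_lam]
  exact pairE_moment2 E disp δB (fun κ l ν => ibr c (B κ) (ibr c (B l) (B ν)))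

/-- (f) `⟨E², δB, i[i[λ_x, B(x)], ∂λ_x]⟩ = Σ_{μνκ} M1_{μνκ} tr δB_μ i[i[B_κ, B_ν], B_ν]` (second term of
(4.29); `(∂λ_x)_ν = B_ν(x)` by (4.23)). [cite: Balaban1987RG1, (4.29) p.288] -/
theorem termF : pairE E δB (fun ν y => ibr c (ibr c (lam disp B y) (B ν)) (B ν))
    = ∑ μ, ∑ ν, ∑ κ, M1 E disp μ ν κ * (δB μ * ibr c (ibr c (B κ) (B ν)) (B ν)).trace := by
  simp_rw [ibr_ibr_lam]
  exact pairE_moment1 E disp δB (fun κ ν => ibr c (ibr c (B κ) (B ν)) (B ν))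

/-- (g) `⟨E², i[δB, B], i[λ_x, B(x)]⟩ = Σ_{μνκ} M1_{μνκ} tr δB_μ i[B_μ, i[B_κ, B_ν]]` (third term of (4.29)).
[cite: Balaban1987RG1, (4.29) p.288] -/
theorem termG : pairE E (fun μ => ibr c (δB μ) (B μ)) (fun ν y => ibr c (lam disp B y) (B ν))
    = ∑ μ, ∑ ν, ∑ κ, M1 E disp μ ν κ * (δB μ * ibr c (B μ) (ibr c (B κ) (B ν))).trace := by
  have h := pairE_moment1 E disp (fun μ => ibr c (δB μ) (B μ)) (fun κ ν => ibr c (B κ) (B ν))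
  simp_rw [ibr_lam, trace_ibr_mul] at h ⊢
  exact h

/-! ## §4. The coefficient table (4.34) -/

/-- The E^{(2)}-expression on the right of **(4.31)** (the term n = 3 of (4.20) after the Ward–Takahashi
reductions, all fields at the point x):
`⟨E², δB, i[λ_x, B(x)]⟩ + 2⟨E², δB, i[λ_x, B(·,x)]⟩ − ⟨E², δB, i[B(·,x), B(x)]⟩ − ⟨E², i[δB, B], B(·,x)⟩`.
[cite: Balaban1987RG1, (4.31) p.289] -/
def rhs431 : A :=
  pairE E δB (fun ν y => ibr c (lam disp B y) (B ν))
    + (2 : 𝕜) • pairE E δB (fun ν y => ibr c (lam disp B y) (Bxy disp C y ν))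
    - pairE E δB (fun ν y => ibr c (Bxy disp C y ν) (B ν))
    - pairE E (fun μ => ibr c (δB μ) (B μ)) (fun ν y => Bxy disp C y ν)

/-- The E^{(2)}-expression on the right of **(4.29)** (the term n = 4 of (4.20)):
`2⟨E², δB, i[λ_x, i[λ_x, B(x)]]⟩ − ⟨E², δB, i[i[λ_x, B(x)], ∂λ_x]⟩ − (3/2)⟨E², i[δB, B], i[λ_x, B(x)]⟩`.
[cite: Balaban1987RG1, (4.29) p.288] -/
def rhs429 : A :=
  (2 : 𝕜) • pairE E δB (fun ν y => ibr c (lam disp B y) (ibr c (lam disp B y) (B ν)))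
    - pairE E δB (fun ν y => ibr c (ibr c (lam disp B y) (B ν)) (B ν))
    - (3 / 2 : 𝕜) • pairE E (fun μ => ibr c (δB μ) (B μ)) (fun ν y => ibr c (lam disp B y) (B ν))

/-- **(4.20)** with (4.31), (4.29) inserted: `⟨E², δB, B⟩ + (1/2!)·[(4.31)] + (1/3!)·[(4.29)]` («(4.6) =
Σ_{n=2}^{4} (1/(n−1)!) ⟨E^{(n)}, δB, ⊗^{n−1} B⟩»); `Bf ν y = B_ν(y)` is the not-yet-localized field of the n = 2
term. [cite: Balaban1987RG1, (4.20) p.285] -/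
def sum420 (Bf : Fin d → Y → Matrix n n A) : A :=
  pairE E δB Bf + ((Nat.factorial 2 : ℕ) : 𝕜)⁻¹ • rhs431 E disp c δB B C
    + ((Nat.factorial 3 : ℕ) : 𝕜)⁻¹ • rhs429 E disp c δB B

/-- **Block 2 of (4.34)**: `Σ_{μ,ν,κ,λ} (Σ_y E²_{μν}(y_κ − x_κ)(y_λ − x_λ)) {tr δB_μ i[B_κ, ∂_λB_ν]
+ ⅓ tr δB_μ i[B_κ, i[B_λ, B_ν]]}`. [cite: Balaban1987RG1, (4.34) p.289] -/
def block2 : A :=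
  ∑ μ, ∑ ν, ∑ κ, ∑ l, M2 E disp μ ν κ l *
    ((δB μ * ibr c (B κ) (C l ν)).trace + (3 : 𝕜)⁻¹ • (δB μ * ibr c (B κ) (ibr c (B l) (B ν))).trace)

/-- **Block 3 of (4.34)** (pp. 289–290): `Σ_{μ,ν,κ} (Σ_y E²_{μν}(y_κ − x_κ)) {½ tr δB_μ i[B_κ, B_ν]
− ½ tr δB_μ i[∂_κB_ν, B_ν] − ½ tr δB_μ i[B_μ, ∂_κB_ν] − (1/3!) tr δB_μ i[i[B_κ, B_ν], B_ν] − ¼ tr δB_μ i[B_μ, i[B_κ, B_ν]]}`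
— the printed index pattern, letter for letter. [cite: Balaban1987RG1, (4.34) pp.289–290] -/
def block3 : A :=
  ∑ μ, ∑ ν, ∑ κ, M1 E disp μ ν κ *
    ((2 : 𝕜)⁻¹ • (δB μ * ibr c (B κ) (B ν)).trace
      - (2 : 𝕜)⁻¹ • (δB μ * ibr c (C κ ν) (B ν)).trace
      - (2 : 𝕜)⁻¹ • (δB μ * ibr c (B μ) (C κ ν)).trace
      - ((Nat.factorial 3 : ℕ) : 𝕜)⁻¹ • (δB μ * ibr c (ibr c (B κ) (B ν)) (B ν)).trace
      - (4 : 𝕜)⁻¹ • (δB μ * ibr c (B μ) (ibr c (B κ) (B ν))).trace)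

/-- The right-hand side of **(4.34)** without «(the irrelevant terms)»: block 1 `⟨E²(X), δB, B⟩` + block 2 +
block 3. [cite: Balaban1987RG1, (4.34) pp.289–290] -/
def rhs434 (Bf : Fin d → Y → Matrix n n A) : A :=
  pairE E δB Bf + block2 E disp c δB B C + block3 E disp c δB B C

/-- **THE TABLE (4.34)** («Let us write the result of the preceding analysis»): the weighted sum (4.20) of the
E^{(2)}-expressions (4.31), (4.29) IS block 1 + block 2 + block 3 of (4.34), with exactly the printed coefficients
and indices — for every kernel, every displacement table, every field, in every dimension.
[cite: Balaban1987RG1, (4.34) pp.289–290] -/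
theorem eq434 [CharZero 𝕜] (Bf : Fin d → Y → Matrix n n A) :
    sum420 E disp c δB B C Bf = rhs434 E disp c δB B C Bf := by
  unfold sum420 rhs434 rhs431 rhs429 block2 block3
  rw [termA, termB, termC, termD, termE, termF, termG]
  rw [show ((Nat.factorial 2 : ℕ) : 𝕜) = 2 by rw [show Nat.factorial 2 = 2 from rfl]; norm_num,
    show ((Nat.factorial 3 : ℕ) : 𝕜) = 6 by rw [show Nat.factorial 3 = 6 from rfl]; norm_num]
  simp only [mul_add, mul_sub, mul_smul_comm, Finset.sum_add_distrib, Finset.sum_sub_distrib, ← Finset.smul_sum]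
  module

/-! ## §5. (4.43) ⇒ (4.44), and (4.45) -/

/-- Kronecker's δ with values in `A`. [folklore] -/
def kdA (a b : Fin d) : A := if a = b then 1 else 0

/-- `Σ_κ δ_{aκ} f κ = f a`. [folklore] -/
theorem sum_kdA_mul (a : Fin d) (f : Fin d → A) : ∑ κ, kdA (A := A) a κ * f κ = f a := by
  rw [Fintype.sum_eq_single a (fun κ hκ => by simp [kdA, Ne.symm hκ])]
  simp [kdA]

/-- Contraction of a two-index table with the moment tensor of (4.43):
`Σ_{κλ} β(δ_{μκ}δ_{νλ} + δ_{μλ}δ_{νκ} − 2δ_{μν}δ_{κλ}) T_{κλ} = β(T_{μν} + T_{νμ} − 2δ_{μν} Σ_κ T_{κκ})`. [folklore] -/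
theorem moment443_contract (β : A) (T : Fin d → Fin d → A) (μ ν : Fin d) :
    ∑ κ, ∑ l, β * (kdA μ κ * kdA ν l + kdA μ l * kdA ν κ - 2 * kdA μ ν * kdA κ l) * T κ l
      = β * (T μ ν + T ν μ - 2 * (kdA μ ν * ∑ κ, T κ κ)) := by
  have h1 : ∑ κ, ∑ l, kdA (A := A) μ κ * kdA ν l * T κ l = T μ ν := by
    have : ∀ κ, ∑ l, kdA (A := A) μ κ * kdA ν l * T κ l = kdA μ κ * T κ ν := by
      intro κ
      simp_rw [mul_assoc, ← Finset.mul_sum, sum_kdA_mul]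
    simp_rw [this, sum_kdA_mul]
  have h2 : ∑ κ, ∑ l, kdA (A := A) μ l * kdA ν κ * T κ l = T ν μ := by
    have : ∀ κ, ∑ l, kdA (A := A) μ l * kdA ν κ * T κ l = kdA ν κ * T κ μ := by
      intro κ
      have hh : ∀ l, kdA (A := A) μ l * kdA ν κ * T κ l = kdA ν κ * (kdA μ l * T κ l) := by intro l; ring
      simp_rw [hh, ← Finset.mul_sum, sum_kdA_mul]
    simp_rw [this, sum_kdA_mul]
  have h3 : ∑ κ, ∑ l, kdA (A := A) μ ν * kdA κ l * T κ l = kdA μ ν * ∑ κ, T κ κ := by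
    simp_rw [mul_assoc, ← Finset.mul_sum, sum_kdA_mul]
  have hs : ∀ κ l, β * (kdA (A := A) μ κ * kdA ν l + kdA μ l * kdA ν κ - 2 * kdA μ ν * kdA κ l) * T κ l
      = β * (kdA μ κ * kdA ν l * T κ l) + β * (kdA μ l * kdA ν κ * T κ l)
        - (2 * β) * (kdA μ ν * kdA κ l * T κ l) := by
    intro κ l; ring
  simp_rw [hs, Finset.sum_sub_distrib, Finset.sum_add_distrib, ← Finset.mul_sum, h1, h2, h3]
  ring

/-- **The cubic regrouping of (4.44)** (matrix identity, before the trace):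
`i[B_μ, ∂_νB_ν] + i[B_ν, ∂_μB_ν] − 2 i[B_ν, ∂_νB_μ] = i[B_ν, (∂B)_{μν}] + i[B_μ, ∂_νB_ν] + i[∂_νB_μ, B_ν]`
with `(∂B)_{μν} = ∂_μB_ν − ∂_νB_μ`. [cite: Balaban1987RG1, (4.44) p.291] -/
theorem cubic444 (μ ν : Fin d) :
    ibr c (B μ) (C ν ν) + ibr c (B ν) (C μ ν) - (2 : 𝕜) • ibr c (B ν) (C ν μ)
      = ibr c (B ν) (C μ ν - C ν μ) + ibr c (B μ) (C ν ν) + ibr c (C ν μ) (B ν) := by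
  rw [ibr_sub_right, ibr_anticomm c (B ν) (C ν μ)]
  module

/-- **The quartic contraction of (4.44)**: `⅓ (i[B_μ, i[B_ν, B_ν]] + i[B_ν, i[B_μ, B_ν]] − 2 i[B_ν, i[B_ν, B_μ]])
= i[B_ν, i[B_μ, B_ν]]` — the first bracket vanishes and the other two add up to `3 × ⅓ = 1`.
[cite: Balaban1987RG1, (4.44) p.291] -/
theorem quartic444 [CharZero 𝕜] (μ ν : Fin d) :
    (3 : 𝕜)⁻¹ • (ibr c (B μ) (ibr c (B ν) (B ν)) + ibr c (B ν) (ibr c (B μ) (B ν))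
      - (2 : 𝕜) • ibr c (B ν) (ibr c (B ν) (B μ))) = ibr c (B ν) (ibr c (B μ) (B ν)) := by
  rw [ibr_self, ibr_zero_right, ibr_anticomm c (B μ) (B ν)]
  simp only [ibr, Matrix.mul_neg, Matrix.neg_mul, smul_sub, smul_neg]
  module

/-- The diagonal collapse `Σ_{μν} δ_{μν} S_{μν} = Σ_μ S_{μμ}` combined with the contraction
`moment443_contract`, for a four-index table: `Σ_{μνκλ} β(δδ + δδ − 2δδ)_{μνκλ} T_{μνκλ}
= β Σ_{μν} (T_{μνμν} + T_{μννμ} − 2T_{μμνν})`. [folklore] -/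
theorem moment443_contract4 (β : A) (T : Fin d → Fin d → Fin d → Fin d → A) :
    ∑ μ, ∑ ν, ∑ κ, ∑ l, β * (kdA μ κ * kdA ν l + kdA μ l * kdA ν κ - 2 * kdA μ ν * kdA κ l) * T μ ν κ l
      = β * ∑ μ, ∑ ν, (T μ ν μ ν + T μ ν ν μ - 2 * T μ μ ν ν) := by
  simp_rw [moment443_contract]
  have h3 : ∑ μ, ∑ ν, kdA (A := A) μ ν * ∑ κ, T μ ν κ κ = ∑ μ, ∑ ν, T μ μ ν ν :=
    Finset.sum_congr rfl fun μ _ => sum_kdA_mul μ (fun ν => ∑ κ, T μ ν κ κ)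
  have e : ∀ μ ν, β * (T μ ν μ ν + T μ ν ν μ - 2 * (kdA (A := A) μ ν * ∑ κ, T μ ν κ κ))
      = β * T μ ν μ ν + β * T μ ν ν μ - (2 * β) * (kdA μ ν * ∑ κ, T μ ν κ κ) := by
    intros; ring
  simp_rw [e]
  simp only [Finset.sum_sub_distrib, Finset.sum_add_distrib, ← Finset.mul_sum, h3]
  ring

/-- The density of **(4.44)** at the point x (without the factor β_j(g_{j−1})), for an arbitrary table
`C κ ν = (∂_κB_ν)(x)` of first derivatives, with «(δB)_{μν}» READ «(∂B)_{μν} = ∂_μB_ν − ∂_νB_μ» (remark (M1)):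
`Σ_{μ,ν} tr δB_μ {i[B_ν, (∂B)_{μν}] + i[B_μ, ∂_νB_ν] + i[∂_νB_μ, B_ν] + i[B_ν, i[B_μ, B_ν]]}`.
[cite: Balaban1987RG1, (4.44) p.291] -/
def dens444pt : A :=
  ∑ μ, ∑ ν, (δB μ * (ibr c (B ν) (C μ ν - C ν μ) + ibr c (B μ) (C ν ν) + ibr c (C ν μ) (B ν)
    + ibr c (B ν) (ibr c (B μ) (B ν)))).trace

/-- **(4.43) ⇒ (4.44)** («Using this equality we represent the second term as»): if the second-moment kernel is
`β(δ_{μκ}δ_{νλ} + δ_{μλ}δ_{νκ} − 2δ_{μν}δ_{κλ})` then block 2 of (4.34) equals β times the density (4.44) — with the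
field strength `(∂B)_{μν}` in the first bracket (remark (M1)), coefficient 1 on every term.
[cite: Balaban1987RG1, (4.43)–(4.44) p.291] -/
theorem block2_of_moments443 [CharZero 𝕜] (β : A)
    (hM2 : ∀ μ ν κ l, M2 E disp μ ν κ l
      = β * (kdA μ κ * kdA ν l + kdA μ l * kdA ν κ - 2 * kdA μ ν * kdA κ l)) :
    block2 E disp c δB B C = β * dens444pt c δB B C := by
  unfold block2 dens444pt
  simp_rw [hM2]
  have h := moment443_contract4 β (fun μ ν κ l =>
    (δB μ * ibr c (B κ) (C l ν)).trace + (3 : 𝕜)⁻¹ • (δB μ * ibr c (B κ) (ibr c (B l) (B ν))).trace)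
  beta_reduce at h
  rw [h]
  congr 1
  refine Finset.sum_congr rfl fun μ _ => Finset.sum_congr rfl fun ν _ => ?_
  have hc := congrArg (fun X : Matrix n n A => (δB μ * X).trace) (cubic444 c B C μ ν)
  have hq := congrArg (fun X : Matrix n n A => (δB μ * X).trace) (quartic444 c B μ ν)
  simp only [Matrix.mul_add, Matrix.mul_sub, Matrix.mul_smul, Matrix.trace_add, Matrix.trace_sub,
    Matrix.trace_smul, Algebra.smul_def, map_ofNat] at hc hq ⊢
  linear_combination hc + hq

/-- **(4.45)** («hence this term vanishes»): if the first-moment kernel vanishes, block 3 of (4.34) is zero.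
[cite: Balaban1987RG1, (4.45) p.292] -/
theorem block3_eq_zero_of_moments445 (hM1 : ∀ μ ν κ, M1 E disp μ ν κ = 0) :
    block3 E disp c δB B C = 0 := by
  unfold block3
  simp [hM1]

/-- The moment tensor of (4.43) at `κ = μ`, `λ = ν`, `μ ≠ ν` equals 1: `Σ_y Δ_{μν}(x − y)(y_μ − x_μ)(y_ν − x_ν) = β`
— the normalization «β = Σ_x Π_{μν}(x)x_μx_ν for μ ≠ ν» of (5.42)/(1.22). [cite: Balaban1987RG1, (4.43) p.291; (5.42) p.297] -/
theorem moments443_offdiag {μ ν : Fin d} (h : μ ≠ ν) :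
    kdA (A := A) μ μ * kdA ν ν + kdA μ ν * kdA ν μ - 2 * kdA μ ν * kdA μ ν = 1 := by
  simp [kdA, h]

/-- The moment tensor of (4.43) at `μ = ν`, `κ = λ`, `μ ≠ κ` equals −2. [cite: Balaban1987RG1, (4.43) p.291] -/
theorem moments443_trace {μ κ : Fin d} (h : μ ≠ κ) :
    kdA (A := A) μ κ * kdA μ κ + kdA μ κ * kdA μ κ - 2 * kdA μ μ * kdA κ κ = -2 := by
  simp [kdA, h]

end Pointwise

/-! ### The tensor of (4.43) is minus the Hessian of the transverse symbol -/

section TransverseSymbol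

open MvPolynomial

variable {d : ℕ}

/-- Kronecker's δ in ℚ. [folklore] -/
def kd (a b : Fin d) : ℚ := if a = b then 1 else 0

/-- Symmetry of δ. [folklore] -/
theorem kd_comm (a b : Fin d) : kd a b = kd b a := by
  unfold kd
  by_cases h : a = b
  · subst h; simp
  · simp [h, Ne.symm h]

/-- `δ_{ab} = 0` for `a ≠ b`. [folklore] -/
theorem kd_of_ne {a b : Fin d} (h : a ≠ b) : kd a b = 0 := by simp [kd, h]

/-- `C δ_{ab}` as an `if`. [folklore] -/
theorem C_kd (a b : Fin d) : (C (kd a b) : MvPolynomial (Fin d) ℚ) = if a = b then 1 else 0 := by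
  unfold kd; split_ifs <;> simp

/-- The transverse symbol `T_{μν}(p′) = p′² δ_{μν} − p′_μ p′_ν` — the leading term of (4.41)
«Δ_{j,μν}(p′) = Δ₀(p′)δ_{μν} − ∂̄¹_μ(p′)∂¹_ν(p′) + (terms of higher order in p′)» under the normalization
Δ₀(p′) = p′² + O(p′⁴), ∂̄¹_μ(p′)∂¹_ν(p′) = p′_μp′_ν + O(|p′|³) of the symbols, which the paper takes by reference from
[10] («see (1.29)–(1.37) [10] for an explanation of symbols») and which is NOT proved here — as an exact polynomial in the
`d` momenta. [cite: Balaban1987RG1, (4.41) p.291] -/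
noncomputable def transverse (μ ν : Fin d) : MvPolynomial (Fin d) ℚ :=
  C (kd μ ν) * (∑ ρ, X ρ * X ρ) - X μ * X ν

/-- `∂X_ρ/∂p_σ = δ_{ρσ}`. [folklore] -/
theorem pderiv_X_kd (σ ρ : Fin d) : pderiv σ (X ρ : MvPolynomial (Fin d) ℚ) = C (kd ρ σ) := by
  rw [pderiv_X, Pi.single_apply, C_kd]

/-- `∂(X_ρX_τ)/∂p_σ = δ_{τσ}X_ρ + δ_{ρσ}X_τ`. [folklore] -/
theorem pderiv_XX (σ ρ τ : Fin d) :
    pderiv σ (X ρ * X τ : MvPolynomial (Fin d) ℚ) = C (kd τ σ) * X ρ + C (kd ρ σ) * X τ := by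
  rw [Derivation.leibniz, pderiv_X_kd, pderiv_X_kd, smul_eq_mul, smul_eq_mul]
  ring

/-- `∂(Σ_ρ X_ρ²)/∂p_σ = 2X_σ`. [folklore] -/
theorem pderiv_sumXX (σ : Fin d) :
    pderiv σ (∑ ρ, X ρ * X ρ : MvPolynomial (Fin d) ℚ) = 2 * X σ := by
  rw [map_sum]
  simp_rw [pderiv_XX]
  rw [Finset.sum_eq_single σ]
  · simp [kd]; ring
  · intro b _ hb; simp [kd_of_ne hb]
  · intro h; exact absurd (Finset.mem_univ σ) h

/-- First partials of the transverse symbol: `∂T_{μν}/∂p_σ = 2δ_{μν}X_σ − δ_{μσ}X_ν − δ_{νσ}X_μ`. [folklore] -/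
theorem pderiv_transverse (μ ν σ : Fin d) : pderiv σ (transverse μ ν) =
    C (2 * kd μ ν) * X σ - C (kd μ σ) * X ν - C (kd ν σ) * X μ := by
  unfold transverse
  rw [map_sub, Derivation.leibniz, pderiv_C, smul_zero, add_zero, smul_eq_mul, pderiv_sumXX, pderiv_XX]
  simp only [map_mul, map_ofNat]
  ring

/-- Second partials: `∂²T_{μν}/∂p_κ∂p_σ = 2δ_{κσ}δ_{μν} − δ_{μκ}δ_{νσ} − δ_{μσ}δ_{νκ}` (a constant). [folklore] -/
theorem pderiv_pderiv_transverse (μ ν κ σ : Fin d) : pderiv κ (pderiv σ (transverse μ ν)) =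
    C (2 * kd κ σ * kd μ ν - kd μ κ * kd ν σ - kd μ σ * kd ν κ) := by
  rw [pderiv_transverse]
  simp only [map_sub, Derivation.leibniz, pderiv_C, smul_eq_mul, mul_zero, add_zero, pderiv_X_kd]
  rw [kd_comm σ κ]
  simp only [map_mul, map_ofNat]
  ring

/-- **(4.43), the tensor**: minus the Hessian of the transverse symbol is `δ_{μκ}δ_{νλ} + δ_{μλ}δ_{νκ} − 2δ_{μν}δ_{κλ}`
— «−((∂²/∂p′_κ∂p′_λ)Δ_{j,μν})(0) = δ_{μκ}δ_{νλ} + δ_{μλ}δ_{νκ} − 2δ_{μν}δ_{κλ}» for the leading symbol.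
[cite: Balaban1987RG1, (4.43) p.291] -/
theorem neg_hessian_transverse (μ ν κ σ : Fin d) : - pderiv κ (pderiv σ (transverse μ ν)) =
    C (kd μ κ * kd ν σ + kd μ σ * kd ν κ - 2 * kd μ ν * kd κ σ) := by
  rw [pderiv_pderiv_transverse, ← map_neg]
  congr 1
  ring

end TransverseSymbol

/-! ## §6. The field-strength identity: (4.42) + (4.44) = β × the first variation of `¼ Σ tr F²` -/

section Differential

variable {𝕜 : Type*} [Field 𝕜]
variable {A : Type*} [CommRing A] [Algebra 𝕜 A]
variable {n : Type*} [Fintype n]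
variable {d : ℕ}

/-- `∂_κ` acting entrywise on a matrix of functions (`D κ` a `𝕜`-derivation of `A`). [folklore] -/
def pd (D : Fin d → Derivation 𝕜 A A) (κ : Fin d) (M : Matrix n n A) : Matrix n n A := M.map (D κ)

variable (D : Fin d → Derivation 𝕜 A A) (c : 𝕜)

omit [Fintype n] in
/-- Additivity of `∂_κ`. [folklore] -/
theorem pd_add (κ : Fin d) (M N : Matrix n n A) : pd D κ (M + N) = pd D κ M + pd D κ N :=
  Matrix.map_add _ (map_add (D κ)) M N

omit [Fintype n] in
/-- `∂_κ(M − N) = ∂_κM − ∂_κN`. [folklore] -/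
theorem pd_sub (κ : Fin d) (M N : Matrix n n A) : pd D κ (M - N) = pd D κ M - pd D κ N :=
  Matrix.map_sub _ (map_sub (D κ)) M N

omit [Fintype n] in
/-- Scalars pass through `∂_κ`. [folklore] -/
theorem pd_smul (κ : Fin d) (t : 𝕜) (M : Matrix n n A) : pd D κ (t • M) = t • pd D κ M := by
  ext i j
  simp [pd]

/-- **Leibniz' rule for matrix products**: `∂_κ(MN) = (∂_κM)N + M(∂_κN)`. [folklore] -/
theorem pd_mul (κ : Fin d) (M N : Matrix n n A) : pd D κ (M * N) = pd D κ M * N + M * pd D κ N := by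
  ext i j
  simp [pd, Matrix.mul_apply, map_sum, (D κ).leibniz, Finset.sum_add_distrib, mul_comm, add_comm]

/-- The trace commutes with `∂_κ`: `tr ∂_κM = ∂_κ tr M`. [folklore] -/
theorem trace_pd (κ : Fin d) (M : Matrix n n A) : (pd D κ M).trace = D κ M.trace := by
  simp [pd, Matrix.trace, map_sum]

/-- Leibniz' rule for the bracket: `∂_κ i[X, Y] = i[∂_κX, Y] + i[X, ∂_κY]`. [folklore] -/
theorem pd_ibr (κ : Fin d) (X Y : Matrix n n A) :
    pd D κ (ibr c X Y) = ibr c (pd D κ X) Y + ibr c X (pd D κ Y) := by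
  simp only [ibr, pd_smul, pd_sub, pd_mul, ← smul_add]
  congr 1
  abel

/-- `(∂X)_{μν} = ∂_μX_ν − ∂_νX_μ` («(∂B)_{μν}», «(∂δB)_{μν}» of (4.42)). [cite: Balaban1987RG1, (4.42) p.291] -/
def curl (X : Fin d → Matrix n n A) (μ ν : Fin d) : Matrix n n A := pd D μ (X ν) - pd D ν (X μ)

/-- The field strength `F_{μν}(B) = ∂_μB_ν − ∂_νB_μ + i[B_μ, B_ν]` of the parametrization `U(b) = exp(iηB(b))`
(continuum density of the Wilson action `A(U) = Σ_p (1 − Re tr U(∂p))`: `¼ Σ_{μν} tr F_{μν}²` per site).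
[folklore] -/
def Fs (B : Fin d → Matrix n n A) (μ ν : Fin d) : Matrix n n A := curl D B μ ν + ibr c (B μ) (B ν)

/-- The first variation of `F` in the direction δB: `δF_{μν} = ∂_μδB_ν − ∂_νδB_μ + i[δB_μ, B_ν] + i[B_μ, δB_ν]`.
[folklore] -/
def dF (B δB : Fin d → Matrix n n A) (μ ν : Fin d) : Matrix n n A :=
  curl D δB μ ν + ibr c (δB μ) (B ν) + ibr c (B μ) (δB ν)

/-- The Yang–Mills density `¼ Σ_{μ,ν} tr F_{μν}(B)²`. [folklore] -/
def ym (B : Fin d → Matrix n n A) : A := (4 : 𝕜)⁻¹ • ∑ μ, ∑ ν, (Fs D c B μ ν * Fs D c B μ ν).trace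

/-- `½ Σ_{μ,ν} tr(F_{μν} δF_{μν})` — the first variation of `ym` (`ym_add_smul`). [folklore] -/
def firstVar (B δB : Fin d → Matrix n n A) : A :=
  (2 : 𝕜)⁻¹ • ∑ μ, ∑ ν, (Fs D c B μ ν * dF D c B δB μ ν).trace

/-- The density of **(4.42)** (without β_j(g_{j−1})): `½ Σ_{μ,ν} tr(∂δB)_{μν}(∂B)_{μν}`.
[cite: Balaban1987RG1, (4.42) p.291] -/
def dens442 (B δB : Fin d → Matrix n n A) : A :=
  (2 : 𝕜)⁻¹ • ∑ μ, ∑ ν, (curl D δB μ ν * curl D B μ ν).trace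

/-- The density of **(4.44)** (without β_j(g_{j−1})): `dens444pt` at `C κ ν := ∂_κB_ν`, i.e.
`Σ_{μ,ν} tr δB_μ{i[B_ν, (∂B)_{μν}] + i[B_μ, ∂_νB_ν] + i[∂_νB_μ, B_ν] + i[B_ν, i[B_μ, B_ν]]}`.
[cite: Balaban1987RG1, (4.44) p.291] -/
def dens444 (B δB : Fin d → Matrix n n A) : A := dens444pt c δB B (fun κ ν => pd D κ (B ν))

/-- The current `J_μ = Σ_ν tr(i[B_μ, B_ν] δB_ν)` whose divergence is the boundary term. [folklore] -/
def cur (B δB : Fin d → Matrix n n A) (μ : Fin d) : A := ∑ ν, (ibr c (B μ) (B ν) * δB ν).trace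

/-- The `t²`-coefficient of `ym (B + tδB)`. [folklore] -/
def R2 (B δB : Fin d → Matrix n n A) : A :=
  (4 : 𝕜)⁻¹ • ∑ μ, ∑ ν, ((dF D c B δB μ ν * dF D c B δB μ ν).trace
    + (2 : 𝕜) • (Fs D c B μ ν * ibr c (δB μ) (δB ν)).trace)

/-- The `t³`-coefficient of `ym (B + tδB)`. [folklore] -/
def R3 (B δB : Fin d → Matrix n n A) : A :=
  (2 : 𝕜)⁻¹ • ∑ μ, ∑ ν, (dF D c B δB μ ν * ibr c (δB μ) (δB ν)).trace

/-- The `t⁴`-coefficient of `ym (B + tδB)`. [folklore] -/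
def R4 (δB : Fin d → Matrix n n A) : A :=
  (4 : 𝕜)⁻¹ • ∑ μ, ∑ ν, (ibr c (δB μ) (δB ν) * ibr c (δB μ) (δB ν)).trace

omit [Fintype n] in
/-- `(∂X)_{νμ} = −(∂X)_{μν}`. [folklore] -/
theorem curl_swap (X : Fin d → Matrix n n A) (μ ν : Fin d) : curl D X ν μ = - curl D X μ ν := by
  simp [curl]

omit [Fintype n] in
/-- `curl` is additive. [folklore] -/
theorem curl_add (X X' : Fin d → Matrix n n A) (μ ν : Fin d) :
    curl D (X + X') μ ν = curl D X μ ν + curl D X' μ ν := by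
  simp only [curl, Pi.add_apply, pd_add]
  abel

omit [Fintype n] in
/-- `curl` is `𝕜`-homogeneous. [folklore] -/
theorem curl_smul (t : 𝕜) (X : Fin d → Matrix n n A) (μ ν : Fin d) :
    curl D (t • X) μ ν = t • curl D X μ ν := by
  simp only [curl, Pi.smul_apply, pd_smul, smul_sub]

/-- **`F(B + tδB) = F(B) + t δF + t² i[δB_μ, δB_ν]`** — exact, so `dF` IS the derivative at t = 0. [folklore] -/
theorem Fs_add_smul (B δB : Fin d → Matrix n n A) (t : 𝕜) (μ ν : Fin d) :
    Fs D c (B + t • δB) μ ν = Fs D c B μ ν + t • dF D c B δB μ ν + (t ^ 2) • ibr c (δB μ) (δB ν) := by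
  simp only [Fs, dF, curl_add, curl_smul, Pi.add_apply, Pi.smul_apply, ibr_add_left, ibr_add_right,
    ibr_kSmul_left, ibr_kSmul_right]
  module

/-- Expansion of `tr (P + tQ + t²R)²` with the cross terms symmetrized by `tr(QP) = tr(PQ)`. [folklore] -/
theorem trace_sq_expand (P Q R : Matrix n n A) (t : 𝕜) :
    ((P + t • Q + (t ^ 2) • R) * (P + t • Q + (t ^ 2) • R)).trace
      = (P * P).trace + t • ((2 : 𝕜) • (P * Q).trace)
        + (t ^ 2) • ((Q * Q).trace + (2 : 𝕜) • (P * R).trace)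
        + (t ^ 3) • ((2 : 𝕜) • (Q * R).trace) + (t ^ 4) • (R * R).trace := by
  simp only [Matrix.add_mul, Matrix.mul_add, Matrix.smul_mul, Matrix.mul_smul, Matrix.trace_add,
    Matrix.trace_smul, smul_smul]
  rw [Matrix.trace_mul_comm Q P, Matrix.trace_mul_comm R P, Matrix.trace_mul_comm R Q]
  module

/-- **`¼ Σ tr F(B + tδB)² = ym B + t·firstVar + t²R₂ + t³R₃ + t⁴R₄`**: `firstVar = ½ Σ tr F δF` is the FIRST
VARIATION of the Yang–Mills density in the direction δB. [folklore] -/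
theorem ym_add_smul [CharZero 𝕜] (B δB : Fin d → Matrix n n A) (t : 𝕜) :
    ym D c (B + t • δB) = ym D c B + t • firstVar D c B δB + (t ^ 2) • R2 D c B δB
      + (t ^ 3) • R3 D c B δB + (t ^ 4) • R4 c δB := by
  unfold ym firstVar R2 R3 R4
  simp_rw [Fs_add_smul, trace_sq_expand]
  simp only [Finset.sum_add_distrib, ← Finset.smul_sum]
  module

/-- Swapping the two summation indices. [folklore] -/
theorem sum_swap (f : Fin d → Fin d → A) : ∑ μ, ∑ ν, f ν μ = ∑ μ, ∑ ν, f μ ν := Finset.sum_comm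

/-- The mixed term of `tr F δF` is symmetric under `μ ↔ ν`:
`Σ tr((∂B)_{μν} i[B_μ, δB_ν]) = Σ tr((∂B)_{μν} i[δB_μ, B_ν])`. [folklore] -/
theorem mixed_swap (B δB : Fin d → Matrix n n A) :
    ∑ μ, ∑ ν, (curl D B μ ν * ibr c (B μ) (δB ν)).trace
      = ∑ μ, ∑ ν, (curl D B μ ν * ibr c (δB μ) (B ν)).trace := by
  rw [← sum_swap]
  refine Finset.sum_congr rfl fun a _ => Finset.sum_congr rfl fun b _ => ?_
  rw [curl_swap, ibr_anticomm c (δB a) (B b), neg_mul_neg]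

/-- The quartic term of `tr F δF` is symmetric under `μ ↔ ν`:
`Σ tr(i[B_μ, B_ν] i[B_μ, δB_ν]) = Σ tr(i[B_μ, B_ν] i[δB_μ, B_ν])`. [folklore] -/
theorem quartic_swap (B δB : Fin d → Matrix n n A) :
    ∑ μ, ∑ ν, (ibr c (B μ) (B ν) * ibr c (B μ) (δB ν)).trace
      = ∑ μ, ∑ ν, (ibr c (B μ) (B ν) * ibr c (δB μ) (B ν)).trace := by
  rw [← sum_swap]
  refine Finset.sum_congr rfl fun a _ => Finset.sum_congr rfl fun b _ => ?_
  rw [ibr_anticomm c (B a) (B b), ibr_anticomm c (δB a) (B b), neg_mul_neg]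

/-- The `i[B, B]·(∂δB)` term: `Σ tr(i[B_μ, B_ν](∂δB)_{μν}) = 2 Σ tr(i[B_μ, B_ν] ∂_μδB_ν)`. [folklore] -/
theorem comm_curl (B δB : Fin d → Matrix n n A) :
    ∑ μ, ∑ ν, (ibr c (B μ) (B ν) * curl D δB μ ν).trace
      = (2 : 𝕜) • ∑ μ, ∑ ν, (ibr c (B μ) (B ν) * pd D μ (δB ν)).trace := by
  have h : ∑ μ, ∑ ν, (ibr c (B μ) (B ν) * pd D ν (δB μ)).trace
      = - ∑ μ, ∑ ν, (ibr c (B μ) (B ν) * pd D μ (δB ν)).trace := by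
    rw [← sum_swap]
    simp only [← Finset.sum_neg_distrib]
    refine Finset.sum_congr rfl fun a _ => Finset.sum_congr rfl fun b _ => ?_
    rw [ibr_anticomm c (B a) (B b), neg_mul, Matrix.trace_neg]
  simp only [curl, Matrix.mul_sub, Matrix.trace_sub, Finset.sum_sub_distrib, h]
  module

/-- **Integration by parts** (Leibniz): `Σ tr(i[B_μ, B_ν] ∂_μδB_ν) = Σ_μ ∂_μ J_μ − Σ tr(∂_μ(i[B_μ, B_ν]) δB_ν)`.
[folklore] -/
theorem by_parts (B δB : Fin d → Matrix n n A) :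
    ∑ μ, ∑ ν, (ibr c (B μ) (B ν) * pd D μ (δB ν)).trace
      = ∑ μ, D μ (cur c B δB μ) - ∑ μ, ∑ ν, (pd D μ (ibr c (B μ) (B ν)) * δB ν).trace := by
  unfold cur
  simp_rw [map_sum, ← trace_pd, pd_mul, Matrix.trace_add, Finset.sum_add_distrib]
  abel

/-- The derivative of the commutator regrouped: `Σ tr(∂_μ(i[B_μ, B_ν]) δB_ν) = −Σ tr δB_μ{i[B_μ, ∂_νB_ν]
+ i[∂_νB_μ, B_ν]}` (rename μ ↔ ν, cyclicity, antisymmetry) — the second and third terms of (4.44).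
[cite: Balaban1987RG1, (4.44) p.291] -/
theorem dcomm_regroup (B δB : Fin d → Matrix n n A) :
    ∑ μ, ∑ ν, (pd D μ (ibr c (B μ) (B ν)) * δB ν).trace
      = - ∑ μ, ∑ ν, (δB μ * (ibr c (B μ) (pd D ν (B ν)) + ibr c (pd D ν (B μ)) (B ν))).trace := by
  rw [← sum_swap]
  simp only [← Finset.sum_neg_distrib]
  refine Finset.sum_congr rfl fun a _ => Finset.sum_congr rfl fun b _ => ?_
  rw [pd_ibr, Matrix.trace_mul_comm, ibr_anticomm c (B a) (pd D b (B b)), ibr_anticomm c (pd D b (B a)) (B b)]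
  simp only [Matrix.mul_add, Matrix.mul_neg, Matrix.trace_add, Matrix.trace_neg]
  abel

/-- **THE FIELD-STRENGTH IDENTITY.**  `½ Σ_{μν} tr(F_{μν} δF_{μν}) = ½ Σ tr((∂δB)_{μν}(∂B)_{μν})`
`+ Σ tr δB_μ{i[B_ν, (∂B)_{μν}] + i[B_μ, ∂_νB_ν] + i[∂_νB_μ, B_ν] + i[B_ν, i[B_μ, B_ν]]} + Σ_μ ∂_μ J_μ`:
the densities of (4.42) and (4.44) add up to the first variation of `¼ Σ tr F²` minus a divergence — the algebra
behind «The corresponding terms from (4.34) are equal to (4.42), (4.44) also» (p. 292) and behind renormalizing the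
single coupling in front of the Wilson action. [cite: Balaban1987RG1, (4.42)–(4.44) p.291–292] -/
theorem firstVar_eq [CharZero 𝕜] (B δB : Fin d → Matrix n n A) :
    firstVar D c B δB = dens442 D B δB + dens444 D c B δB + ∑ μ, D μ (cur c B δB μ) := by
  have hS1 : ∑ μ, ∑ ν, (curl D B μ ν * curl D δB μ ν).trace
      = ∑ μ, ∑ ν, (curl D δB μ ν * curl D B μ ν).trace :=
    Finset.sum_congr rfl fun μ _ => Finset.sum_congr rfl fun ν _ => Matrix.trace_mul_comm _ _
  have hS2 : ∑ μ, ∑ ν, (curl D B μ ν * ibr c (δB μ) (B ν)).trace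
      = ∑ μ, ∑ ν, (δB μ * ibr c (B ν) (curl D B μ ν)).trace :=
    Finset.sum_congr rfl fun μ _ => Finset.sum_congr rfl fun ν _ => trace_mul_ibr c _ _ _
  have hS5 : ∑ μ, ∑ ν, (ibr c (B μ) (B ν) * ibr c (δB μ) (B ν)).trace
      = ∑ μ, ∑ ν, (δB μ * ibr c (B ν) (ibr c (B μ) (B ν))).trace :=
    Finset.sum_congr rfl fun μ _ => Finset.sum_congr rfl fun ν _ => trace_mul_ibr c _ _ _
  have hS3 := mixed_swap D c B δB
  have hS6 := quartic_swap c B δB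
  have hS4 := comm_curl D c B δB
  have hW := by_parts D c B δB
  have hW2 := dcomm_regroup D c B δB
  unfold firstVar dens442 dens444 dens444pt Fs dF
  simp only [Matrix.add_mul, Matrix.mul_add, Matrix.trace_add, Finset.sum_add_distrib]
  rw [hS1, hS2, hS3, hS2, hS4, hW, hW2, hS5, hS6, hS5]
  simp only [curl, Matrix.mul_add, Matrix.trace_add, Finset.sum_add_distrib, smul_add, smul_sub, smul_neg]
  module

/-- **Summed form.**  For every `𝕜`-linear functional `ι` killing each `∂_μ` («Σ_x over the lattice»: a total
difference sums to zero), `ι(½ Σ tr F δF) = ι((4.42)-density) + ι((4.44)-density)`. [folklore] -/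
theorem integral_firstVar [CharZero 𝕜] {V : Type*} [AddCommGroup V] [Module 𝕜 V] (ι : A →ₗ[𝕜] V)
    (hι : ∀ μ a, ι (D μ a) = 0) (B δB : Fin d → Matrix n n A) :
    ι (firstVar D c B δB) = ι (dens442 D B δB) + ι (dens444 D c B δB) := by
  rw [firstVar_eq, map_add, map_add, map_sum]
  simp [hι]

/-- **(4.42) + (4.44) = β × δ(¼ Σ tr F²)** in summed form: with the common coefficient β = β_j(g_{j−1}) of (4.42)
and (4.44), `β·ι((4.42)-density) + β·ι((4.44)-density) = β·ι(firstVar)` — the marginal counterterm is β times the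
first variation of the (continuum density of the) Wilson action, which is what «both groups of terms cancel» against
«β_j(g_{j−1})(A(U_j(…)) − A(U_k(…)))» (4.38) expresses. [cite: Balaban1987RG1, p.292 (paragraph after (4.45))] -/
theorem marginal_eq_firstVar [CharZero 𝕜] {V : Type*} [AddCommGroup V] [Module 𝕜 V] (ι : A →ₗ[𝕜] V)
    (hι : ∀ μ a, ι (D μ a) = 0) (β : 𝕜) (B δB : Fin d → Matrix n n A) :
    β • ι (dens442 D B δB) + β • ι (dens444 D c B δB) = β • ι (firstVar D c B δB) := by
  rw [integral_firstVar D c ι hι, smul_add]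

end Differential

end Literature.MathematicalPhysics.QuantumFieldTheory.Balaban1983to89.B12Marginal444
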